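import Literature.Computability.Complexity.OccurrenceObstructionsIP
import Literature.NumberTheory.DiophantineGeometry.SymmetricGroupRepsSignTwist
import Literature.Computability.AlgebraicComplexity.DeterminantalComplexityUniform
import Literature.Computability.AlgebraicComplexity.OrbitClosureProofs
import Literature.Barriers.ValiantsHypothesis.NotViaSaturationsChowProofs
import Literature.NumberTheory.DiophantineGeometry.SchurWeylPlethysmRenameProofs
import Literature.NumberTheory.DiophantineGeometry.KroneckerRectangularStability
import HarnessLib

/-!
# Ikenmeyer–Panova 2017: the transposition property discharged, and IP Thm. 1.4 from the three
# remaining printed parts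

Sibling proofs file (D-0014) of `Literature/Computability/Complexity/OccurrenceObstructionsIP.lean`;
theorems only, no statement of the tree is changed. Letters as there: `n` = permanent size,
`m` = determinant size, `d` = outer degree, everything over `ℂ`.

1. **The transposition property is a theorem.** The named fact
   `Literature.Computability.Complexity.ikenmeyerPanova2017_transposition`
   ("`g(λ, μ, ν) = g(λ, μᵗ, νᵗ)`", IP §1.1) is discharged
   (`ikenmeyerPanova2017_transposition_holds`) by the tree theorem
   `Literature.NumberTheory.DiophantineGeometry.kroneckerCoeff_transpose`
   (`SymmetricGroupRepsSignTwist.lean`: `S^{μᵗ} ≅ S^μ ⊗ sgn`, `χ^{μᵗ} = sgn · χ^μ`, and the character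
   formula for Kronecker coefficients), whose module docstring announces exactly this sibling file.
2. **Consequences.** Every conditional theorem of `OccurrenceObstructionsIP.lean` carrying the
   hypothesis `(htr : ikenmeyerPanova2017_transposition)` is restated without it: the rectangle swap
   `g(λ, a × b, a × b) = g(λ, b × a, b × a)` (`kroneckerCoeff_rectangle_transpose`), IP Lemma 4.2 from
   the square positivity and the semigroup property alone
   (`ikenmeyerPanova2017_lemma_4_2_of_square_pos_of_semigroup`), Thm. 1.7(b) from Thm. 4.6 alone
   (`ikenmeyerPanova2017_thm_1_7b_of_thm_4_6_holds`), and the assemblies of IP Thm. 1.4: after this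
   file, **IP Thm. 1.4 (for IP's own padding, `ikenmeyerPanova2017_thm_1_4`) rests on exactly three
   named facts of IP's paper — Prop. 2.8 (inequality of multiplicities), Thm. 1.7(a) (the six
   exceptional bodies do not occur in `Sym^d Sym^m V`) and Thm. 4.6 (main Kronecker positivity)** —
   for every permanent size `n ≥ 1` outside the single window `n = 2`, `48 < m < 243` not covered by
   any printed argument (`ikenmeyerPanova2017_thm_1_4_of_three_facts`; for `n ≥ 3` verbatim,
   `ikenmeyerPanova2017_thm_1_4_of_three_facts_three_le`), and likewise the two statements the
   printed parts deliver for G20's fresh-variable padding (the orbit closure of the tree fact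
   `Literature.Computability.Complexity.ikenmeyer_panova_rectangular_kronecker_pos`, which is NOT the
   printed theorem — see §1 of the statement file): thresholds `3·max(n²+1, 9)² ≤ m`
   (`kroneckerCoeff_pos_paddedPerOrbitRep_of_three_facts`) and `3(n+1)^4 < m`
   (`kroneckerCoeff_pos_paddedPerOrbitRep_of_three_facts'`, through Thm. 1.7(b)).

Source: C. Ikenmeyer, G. Panova, *Rectangular Kronecker coefficients and plethysms in geometric
complexity theory*, Adv. Math. 319 (2017) 40–66 = arXiv:1512.03798, §1.1 (the transposition
property; Thm. 1.4 and its proof, held text p. 5), §4 (Lemma 4.2, proof of Thm. 1.7, held pp. 9,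
12). Key `IkenmeyerPanova2017`.
-/

noncomputable section

namespace Literature.Computability.Complexity

/-! ### The transposition property (IP §1.1) is a theorem -/

/-- **Discharge of `ikenmeyerPanova2017_transposition`**: `g(λ, μ, ν) = g(λ, μᵗ, νᵗ)` for all
partitions `λ, μ, ν ⊢ N`, over `ℂ` — the tree theorem
`Literature.NumberTheory.DiophantineGeometry.kroneckerCoeff_transpose` (sign twist of Specht
modules and the character formula) at `k = ℂ`.
[cite: IkenmeyerPanova2017, §1.1 (the transposition property; held p. 5)] -/
theorem ikenmeyerPanova2017_transposition_holds : ikenmeyerPanova2017_transposition :=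
  fun lam mu nu => Literature.NumberTheory.DiophantineGeometry.kroneckerCoeff_transpose ℂ lam mu nu

/-- **Transposing the two rectangles, unconditionally**: `g(λ, a × b, a × b) = g(λ, b × a, b × a)`,
the shape being transported from `Nat.Partition (a * b)` to `Nat.Partition (b * a)` by its parts
(IP's constant move "transposing the last two partitions", proofs of Lemma 4.2 and Prop. 4.3).
[cite: IkenmeyerPanova2017, Lemma 4.2 (proof; held: Lemma 19, p. 9)] -/
theorem kroneckerCoeff_rectangle_transpose {a b : ℕ} (lam : Nat.Partition (a * b))
    (lam' : Nat.Partition (b * a)) (h : lam.parts = lam'.parts) :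
    Literature.NumberTheory.DiophantineGeometry.kroneckerCoeff ℂ lam (Nat.Partition.rectangle a b)
        (Nat.Partition.rectangle a b) =
      Literature.NumberTheory.DiophantineGeometry.kroneckerCoeff ℂ lam' (Nat.Partition.rectangle b a)
        (Nat.Partition.rectangle b a) :=
  kroneckerCoeff_rectangle_swap ikenmeyerPanova2017_transposition_holds lam lam' h

/-- **IP Lemma 4.2 (held: Lemma 19) from the square positivity and the semigroup property only**:
"Let `μ = (k × (ks))` and `a ≥ ks`, then `g(k × (ks) + (k(a-ks)), a × k, a × k) > 0`" — the printed
proof (`ikenmeyerPanova2017_lemma_4_2_of_props`) with its third tool, the transposition property,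
now a theorem. [cite: IkenmeyerPanova2017, Lemma 4.2 (held: Lemma 19, p. 9)] -/
theorem ikenmeyerPanova2017_lemma_4_2_of_square_pos_of_semigroup
    (hsq : ikenmeyerPanova2017_square_pos) (hsg : ikenmeyerPanova2017_semigroup) {k s a : ℕ}
    (hks : k * s ≤ a) (mu : Nat.Partition (a * k))
    (hmu : mu.parts = ((Nat.Partition.rectangle k (k * s)).rowAdd
      (Nat.Partition.indiscrete (k * (a - k * s)))).parts) :
    0 < Literature.NumberTheory.DiophantineGeometry.kroneckerCoeff ℂ mu (Nat.Partition.rectangle a k)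
      (Nat.Partition.rectangle a k) :=
  ikenmeyerPanova2017_lemma_4_2_of_props hsq hsg ikenmeyerPanova2017_transposition_holds hks mu hmu

/-- **IP Thm. 1.7(b) from Thm. 4.6 alone** (IP, "Proof of Thm. 1.7", §4, held p. 12: Thm. 4.6 with
`ν = λ̄`, `ℓ = m²`, `a = d`, `b = n`, then the tacit transposition `(n × d)ᵗ = d × n`, now a
theorem). [cite: IkenmeyerPanova2017, §4 (Proof of Thm. 1.7; held: Proof of Thm. 7, p. 12)] -/
theorem ikenmeyerPanova2017_thm_1_7b_of_thm_4_6_holds (h46 : ikenmeyerPanova2017_thm_4_6) :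
    ikenmeyerPanova2017_thm_1_7b :=
  ikenmeyerPanova2017_thm_1_7b_of_thm_4_6 h46 ikenmeyerPanova2017_transposition_holds

/-! ### IP Thm. 1.4 from the three remaining facts: Prop. 2.8, Thm. 1.7(a), Thm. 4.6 -/

/-- **IP Thm. 1.4 at threshold `3·max(n², 9)² ≤ m` for every permanent size `n ≥ 1`, from
Prop. 2.8, Thm. 1.7(a) and Thm. 4.6** (IP's padding `bipPaddedPerOrbitRep`; Kadish–Landsberg, the
BLMW lift and the transposition property being tree theorems): the deeper chain
`ikenmeyerPanova2017_thm_1_4_of_thm_4_6` with `htr` discharged.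
[cite: IkenmeyerPanova2017, Thm. 1.4 (held: Thm. 4), via Prop. 2.8, Thm. 1.7(a), Thm. 4.6] -/
theorem ikenmeyerPanova2017_thm_1_4_of_three_facts_max (h28 : ikenmeyerPanova2017_prop_2_8)
    (h17a : ikenmeyerPanova2017_thm_1_7a) (h46 : ikenmeyerPanova2017_thm_4_6)
    {n m d : ℕ} [NeZero m] (hn0 : 0 < n) (hnm : 3 * (max (n ^ 2) 9) ^ 2 ≤ m)
    (lam : Nat.Partition (m * d)) (hlam : lam.parts.card ≤ m * m)
    (h : Literature.NumberTheory.DiophantineGeometry.HasHighestWeight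
      (Complexity.bipPaddedPerOrbitRep ℂ n m) (partitionWeightLex m lam)) :
    0 < Literature.NumberTheory.DiophantineGeometry.kroneckerCoeff ℂ lam (Nat.Partition.rectangle m d)
      (Nat.Partition.rectangle m d) :=
  ikenmeyerPanova2017_thm_1_4_of_thm_4_6 h28 h17a h46 ikenmeyerPanova2017_transposition_holds hn0
    hnm lam hlam h

/-- **IP Thm. 1.4 (`ikenmeyerPanova2017_thm_1_4`, IP's padding, threshold `3n^4 < m`) from
Prop. 2.8, Thm. 1.7(a) and Thm. 4.6, for every `0 < n` outside the window `n = 2`, `48 < m < 243`**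
(the only part of the printed statement not covered by a printed argument: IP's proof applies
Thm. 1.7(b), whose parameter must be `≥ 3`, to the permanent size; `n = 1` is the Veronese cone,
`ikenmeyerPanova2017_thm_1_4_one`; `n = 2` with `243 ≤ m` follows by invoking Thm. 4.6 directly).
This is `ikenmeyerPanova2017_thm_1_4_of_thm_4_6'` with the transposition property discharged.
[cite: IkenmeyerPanova2017, Thm. 1.4 (held: Thm. 4) and §1.1 (Proof of Thm. 1.4; held p. 5)] -/
theorem ikenmeyerPanova2017_thm_1_4_of_three_facts (h28 : ikenmeyerPanova2017_prop_2_8)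
    (h17a : ikenmeyerPanova2017_thm_1_7a) (h46 : ikenmeyerPanova2017_thm_4_6)
    {n m d : ℕ} [NeZero m] (hn0 : 0 < n) (hnm : 3 * n ^ 4 < m) (h2 : n = 2 → 243 ≤ m)
    (lam : Nat.Partition (m * d)) (hlam : lam.parts.card ≤ m * m)
    (h : Literature.NumberTheory.DiophantineGeometry.HasHighestWeight
      (Complexity.bipPaddedPerOrbitRep ℂ n m) (partitionWeightLex m lam)) :
    0 < Literature.NumberTheory.DiophantineGeometry.kroneckerCoeff ℂ lam (Nat.Partition.rectangle m d)
      (Nat.Partition.rectangle m d) :=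
  ikenmeyerPanova2017_thm_1_4_of_thm_4_6' h28 h17a h46 ikenmeyerPanova2017_transposition_holds hn0
    hnm h2 lam hlam h

/-- **IP Thm. 1.4 verbatim for permanent size `n ≥ 3`** — the range of the printed proof — from
Prop. 2.8, Thm. 1.7(a) and Thm. 4.6 only: once these three named facts are discharged, this is
`ikenmeyerPanova2017_thm_1_4` restricted to `3 ≤ n`.
[cite: IkenmeyerPanova2017, Thm. 1.4 (held: Thm. 4) and §1.1 (Proof of Thm. 1.4; held p. 5)] -/
theorem ikenmeyerPanova2017_thm_1_4_of_three_facts_three_le (h28 : ikenmeyerPanova2017_prop_2_8)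
    (h17a : ikenmeyerPanova2017_thm_1_7a) (h46 : ikenmeyerPanova2017_thm_4_6) :
    ∀ (n m d : ℕ) [NeZero m] (_hn : 3 ≤ n) (_hnm : 3 * n ^ 4 < m)
      (lam : Nat.Partition (m * d)) (_hlam : lam.parts.card ≤ m * m)
      (_h : Literature.NumberTheory.DiophantineGeometry.HasHighestWeight
        (Complexity.bipPaddedPerOrbitRep ℂ n m) (partitionWeightLex m lam)),
      0 < Literature.NumberTheory.DiophantineGeometry.kroneckerCoeff ℂ lam
        (Nat.Partition.rectangle m d) (Nat.Partition.rectangle m d) :=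
  fun _n _m _d _ hn hnm lam hlam h =>
    ikenmeyerPanova2017_thm_1_4_of_three_facts h28 h17a h46 (by omega) hnm (fun h2 => by omega)
      lam hlam h

/-- **The printed route for `n ≥ 3` from Prop. 2.8, Thm. 1.7(a) and Thm. 4.6** (Cor. 1.6 and
Thm. 1.7(b) proved from these as in print, then IP's assembly of §1.1):
`ikenmeyerPanova2017_thm_1_4_of_prop_2_8_thm_4_6` with the transposition property discharged.
[cite: IkenmeyerPanova2017, Thm. 1.4 (held: Thm. 4), via Prop. 2.8, Thm. 1.7(a), Thm. 4.6] -/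
theorem ikenmeyerPanova2017_thm_1_4_of_three_facts_printed_route
    (h28 : ikenmeyerPanova2017_prop_2_8) (h17a : ikenmeyerPanova2017_thm_1_7a)
    (h46 : ikenmeyerPanova2017_thm_4_6)
    {n m d : ℕ} [NeZero m] (hn : 3 ≤ n) (hnm : 3 * n ^ 4 < m) (lam : Nat.Partition (m * d))
    (hlam : lam.parts.card ≤ m * m)
    (h : Literature.NumberTheory.DiophantineGeometry.HasHighestWeight
      (Complexity.bipPaddedPerOrbitRep ℂ n m) (partitionWeightLex m lam)) :
    0 < Literature.NumberTheory.DiophantineGeometry.kroneckerCoeff ℂ lam (Nat.Partition.rectangle m d)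
      (Nat.Partition.rectangle m d) :=
  ikenmeyerPanova2017_thm_1_4_of_prop_2_8_thm_4_6 h28 h17a h46
    ikenmeyerPanova2017_transposition_holds hn hnm lam hlam h

/-! ### What the three facts give for G20's fresh-variable padding -/

/-- **Fresh-variable padding at threshold `3·max(n²+1, 9)² ≤ m` from Prop. 2.8, Thm. 1.7(a) and
Thm. 4.6**: for `λ ⊢ m·d` (at most `m²` parts) occurring in
`ℂ[\overline{GL_{m²} · X₀₀^{m-n} per_n(bottom-right)}]` (`paddedPerOrbitRep`, the orbit closure
of the tree fact `ikenmeyer_panova_rectangular_kronecker_pos`), `g(λ, m×d, m×d) > 0`. Not a printed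
statement (IP's chain run with `ℓ = max(n²+1, 9)`, BIP Thm. 4.9(1)/(2) for the fresh variable);
the tree fact's threshold `3n^4 < m` is not reached. `kroneckerCoeff_pos_paddedPerOrbitRep_of_thm_4_6`
with the transposition property discharged.
[cite: IkenmeyerPanova2017, §4 (Proof of Thm. 1.7; held p. 12) and §1.1 (Proof of Thm. 1.4), with ℓ = max(n² + 1, 9)] -/
theorem kroneckerCoeff_pos_paddedPerOrbitRep_of_three_facts (h28 : ikenmeyerPanova2017_prop_2_8)
    (h17a : ikenmeyerPanova2017_thm_1_7a) (h46 : ikenmeyerPanova2017_thm_4_6)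
    {n m d : ℕ} [NeZero m] (hnm : 3 * (max (n ^ 2 + 1) 9) ^ 2 ≤ m)
    (lam : Nat.Partition (m * d)) (hlam : lam.parts.card ≤ m * m)
    (h : Literature.NumberTheory.DiophantineGeometry.HasHighestWeight
      (Literature.NumberTheory.DiophantineGeometry.paddedPerOrbitRep ℂ n m)
      (partitionWeightLex m lam)) :
    0 < Literature.NumberTheory.DiophantineGeometry.kroneckerCoeff ℂ lam (Nat.Partition.rectangle m d)
      (Nat.Partition.rectangle m d) :=
  kroneckerCoeff_pos_paddedPerOrbitRep_of_thm_4_6 h28 h17a h46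
    ikenmeyerPanova2017_transposition_holds hnm lam hlam h

/-- **Fresh-variable padding at threshold `3(n+1)^4 < m` (`2 ≤ n`) from Prop. 2.8, Thm. 1.7(a) and
Thm. 4.6** — IP's proof run with parameter `M = n + 1` (through Cor. 1.6 and Thm. 1.7(b), proved
from the three facts as in print). Not a printed statement.
[cite: IkenmeyerPanova2017, §1.1 (Proof of Thm. 1.4; held p. 5), with M = n + 1] -/
theorem kroneckerCoeff_pos_paddedPerOrbitRep_of_three_facts' (h28 : ikenmeyerPanova2017_prop_2_8)
    (h17a : ikenmeyerPanova2017_thm_1_7a) (h46 : ikenmeyerPanova2017_thm_4_6)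
    {n m d : ℕ} [NeZero m] (hn : 2 ≤ n) (hnm : 3 * (n + 1) ^ 4 < m) (lam : Nat.Partition (m * d))
    (hlam : lam.parts.card ≤ m * m)
    (h : Literature.NumberTheory.DiophantineGeometry.HasHighestWeight
      (Literature.NumberTheory.DiophantineGeometry.paddedPerOrbitRep ℂ n m)
      (partitionWeightLex m lam)) :
    0 < Literature.NumberTheory.DiophantineGeometry.kroneckerCoeff ℂ lam (Nat.Partition.rectangle m d)
      (Nat.Partition.rectangle m d) :=
  kroneckerCoeff_pos_paddedPerOrbitRep_of_parts' (ikenmeyerPanova2017_cor_1_6_of_prop_2_8 h28) h17a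
    (ikenmeyerPanova2017_thm_1_7b_of_thm_4_6_holds h46) hn hnm lam hlam h

end Literature.Computability.Complexity

/-! ## Appendix (2026-08-15): IP Prop. 2.8 (inequality of multiplicities) is a theorem —
discharge of `ikenmeyerPanova2017_prop_2_8`

C. Ikenmeyer, G. Panova, Adv. Math. 319 (2017), Prop. 2.8 (held arXiv text: Prop. 15): "Fix `ρ`,
and let `(n, d) ∈ St¹(ρ)`, which is true in particular if `n ≥ |ρ|`. Let `λ = ρ(nd)`. Then
`g(λ, n × d, n × d) ≥ a_λ(d[n])`", proved in print (§2.2) by contradiction from Manivel's stability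
(Thm. 2.1 = held Thm. 8), the Kadish–Landsberg lifting (Prop. 2.6(b) = held Prop. 13(b)), the
algebraic Peter–Weyl theorem (Prop. 2.5 = held Prop. 12) and the finiteness of the determinantal
complexity (Lemma 2.7 = held Lemma 14). The formal proof runs the same four ingredients forward,
without the auxiliary variety `Γ^n_m` of padded polynomials (tree letters: determinant size `m`,
`λ ⊢ m·d`, `|λ̄| ≤ m`, `V_m` = forms of degree `m` in `MvPolynomial (MatIdx m) ℂ`):

1. (Lemma 2.7) one size `C` of affine determinantal representation serves every `f ∈ V_m`
   (`exists_forall_hasDetRepr_of_isHomogeneous`, `DeterminantalComplexityUniform.lean`); put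
   `N = m + C`.
2. (Prop. 2.6(b), the lifting) embed `MatIdx m` into `MatIdx N` as the final lexicographic segment
   (`segEmb`, strictly monotone with image an upper set, top to top) and lift a highest-weight
   vector `F` of weight `λ^*` on `ℂ[Sym^m ℂ^{m²}]` to
   `L F = innerLift (topMatIdx N) m N (rename (degIdxMap segEmb) F)`, a highest-weight vector on
   `ℂ[Sym^N ℂ^{N²}]` (the inheritance lemma `rename_mem_highestWeightSpace_coordRep` of
   `NotViaSaturationsChowProofs.lean`, then BIP's inner lifting `innerLift_mem_highestWeightSpace`,
   `PlethysmLifting.lean`) whose weight is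
   `(λ♯N)^*`, `λ♯N = λ + ((N-m)d)` (`partitionWeightLex_rowLift`); its value at the padded form
   `X_top^{N-m} · f` (`f ∈ V_m` placed on the segment) is `F(Δ f)` for the invertible diagonal
   scaling `Δ` of BIP Lemma 5.2 (`aeval_formCoeff_paddedForm_liftHWV`), so the `L F` are linearly independent on
   the padded forms (IP: "the evaluation matrix has full rank").
3. (Mulmuley–Sohoni padding, inside Prop. 2.5) every padded form lies in
   `Ω_N = \overline{GL_{N²} det_N}` since `dc(f) ≤ C ≤ N`
   (`X_pow_mul_rename_mem_endOrbit_detPoly`, `paddedForm_mem_orbitClosure_detFormLex`), hence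
   `F ↦ L F mod I(Ω_N)` is injective on the highest-weight space: `a_λ(d[m]) ≤ mult_{λ♯N} ℂ[Ω_N]`
   (`plethysmCoeff_le_orbitMultiplicity_rowLift`).
4. (Prop. 2.5, Peter–Weyl) `mult_{λ♯N} ℂ[Ω_N] ≤ g(λ♯N, N × d, N × d)`
   (`orbitMultiplicity_det_le_kroneckerCoeff_holds`).
5. (Thm. 2.1, Manivel's stability, upper half) `g(λ♯N, N × d, N × d) ≤ g(λ, m × d, m × d)` because
   `|λ̄| ≤ m` (`kroneckerCoeff_rowLift_le`, iterating `kroneckerCoeff_rectangle_succ_le` of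
   `KroneckerRectangularStability.lean` through the transposition property).

Sources: C. Ikenmeyer, G. Panova, Adv. Math. 319 (2017) 40–66 = arXiv:1512.03798, §2
(Thm. 2.1, Prop. 2.5, Prop. 2.6, Lemma 2.7, Prop. 2.8; held: Thm. 8, Prop. 12, Prop. 13,
Lemma 14, Prop. 15) [key `IkenmeyerPanova2017`]; L. Manivel, J. Algebraic Combin. 33 (2011), Thm. 1
[key `Manivel2011`]; P. Bürgisser, C. Ikenmeyer, G. Panova, J. AMS 32 (2019), Lemma 5.2–5.3,
Thm. 5.4 [key `BurgisserIkenmeyerPanovaJAMS2019`]; K. Mulmuley, M. Sohoni, SIAM J. Comput. 31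
(2001), Prop. 4.4 [key `MulmuleySohoni2001`].
-/

namespace Literature.Computability.Complexity

open MvPolynomial
open Literature.NumberTheory.DiophantineGeometry Literature.Computability.AlgebraicComplexity
open Literature.Barriers.ValiantsHypothesis (degIdxMap degIdxMap_val rename_mem_highestWeightSpace_coordRep)

/-! ### Adding boxes to the first row: `λ♯` and the iterated stability bound -/

section RowLift

variable {m d : ℕ}

/-- `λ♯(m+j)`: the partition `λ ⊢ m·d` with `j·d` boxes added to its first row, as a partition of
`(m+j)·d` (IP's `ρ(nd)` for `n = m + j`, `ρ = λ̄`; the parts are those of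
`λ.rowAdd (indiscrete (j·d))`). [cite: IkenmeyerPanova2017, §2.1 (ρ(nd)) and Prop. 2.6(b) (λ + (dn - dm))] -/
def rowLift (lam : Nat.Partition (m * d)) (j : ℕ) : Nat.Partition ((m + j) * d) :=
  ⟨(lam.rowAdd (Nat.Partition.indiscrete (j * d))).parts,
    fun h => (lam.rowAdd (Nat.Partition.indiscrete (j * d))).parts_pos h,
    by rw [Nat.Partition.parts_sum]; ring⟩

/-- The sorted parts of `λ♯` are those of the row-wise sum. [folklore] -/
theorem sortedParts_rowLift (lam : Nat.Partition (m * d)) (j : ℕ) :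
    (rowLift lam j).sortedParts = (lam.rowAdd (Nat.Partition.indiscrete (j * d))).sortedParts :=
  rfl

/-- The weight of the one-row partition `(c)` is `c ε₀`. [folklore] -/
theorem ofPartition_indiscrete (K c : ℕ) [NeZero K] :
    Weight.ofPartition K (Nat.Partition.indiscrete c) = Pi.single 0 (c : ℤ) := by
  funext i
  rw [Weight.ofPartition]
  rcases Nat.eq_zero_or_pos c with rfl | hc
  · have h0 : (Nat.Partition.indiscrete 0).sortedParts = [] := by
      rw [← List.length_eq_zero_iff, Nat.Partition.length_sortedParts]
      simp
    simp [h0]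
  · rw [sortedParts_indiscrete hc.ne']
    by_cases hi : i = 0
    · subst hi; simp
    · rw [Pi.single_eq_of_ne hi]
      have : (i : ℕ) ≠ 0 := fun h => hi (Fin.ext h)
      obtain ⟨i', hi'⟩ := Nat.exists_eq_succ_of_ne_zero this
      simp [hi']

/-- **The weight of `λ♯`**: `ofPartition K (λ♯(m+j)) = ofPartition K λ + (j d) ε₀`. [folklore] -/
theorem ofPartition_rowLift (K : ℕ) [NeZero K] (lam : Nat.Partition (m * d)) (j : ℕ) :
    Weight.ofPartition K (rowLift lam j) = Weight.ofPartition K lam + Pi.single 0 ((j * d : ℕ) : ℤ) := by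
  have h : Weight.ofPartition K (rowLift lam j) =
      Weight.ofPartition K (lam.rowAdd (Nat.Partition.indiscrete (j * d))) := by
    funext i; rw [Weight.ofPartition, Weight.ofPartition, sortedParts_rowLift]
  rw [h, ofPartition_rowAdd, ofPartition_indiscrete]

/-- The rows of `λ♯`: row `0` is `λ₁ + j d`, the others are those of `λ`. [folklore] -/
theorem getD_sortedParts_rowLift (lam : Nat.Partition (m * d)) (j r : ℕ) :
    (rowLift lam j).sortedParts.getD r 0 = lam.sortedParts.getD r 0 + if r = 0 then j * d else 0 := by
  rw [sortedParts_rowLift, getD_sortedParts_rowAdd]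
  congr 1
  rcases Nat.eq_zero_or_pos (j * d) with h0 | hpos
  · rw [h0]
    have h0' : (Nat.Partition.indiscrete 0).sortedParts = [] := by
      rw [← List.length_eq_zero_iff, Nat.Partition.length_sortedParts]
      simp
    simp [h0']
  · rw [sortedParts_indiscrete hpos.ne']
    rcases r with _ | r <;> simp

/-- `λ♯` has at most `max ℓ(λ) 1` parts. [folklore] -/
theorem card_parts_rowLift_le (lam : Nat.Partition (m * d)) (j : ℕ) :
    (rowLift lam j).parts.card ≤ max lam.parts.card 1 := by
  refine (card_parts_rowAdd_le lam (Nat.Partition.indiscrete (j * d))).trans (max_le_max le_rfl ?_)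
  rcases Nat.eq_zero_or_pos (j * d) with h0 | hpos
  · rw [h0]; simp
  · rw [Nat.Partition.indiscrete_parts hpos.ne']; simp

/-- The first row of `λ♯(m+j)` is `λ₁ + j d`. [folklore] -/
theorem ofPartition_rowLift_zero (K : ℕ) [NeZero K] (lam : Nat.Partition (m * d)) (j : ℕ) :
    Weight.ofPartition K (rowLift lam j) 0 = (lam.parts.sup : ℤ) + ((j * d : ℕ) : ℤ) := by
  rw [ofPartition_rowLift, Pi.add_apply, Pi.single_eq_same, Weight.ofPartition,
    sup_parts_eq_getD_sortedParts]
  rfl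

/-- `λ♯(m+0) = λ` (same parts). [folklore] -/
theorem parts_rowLift_zero (lam : Nat.Partition (m * d)) : (rowLift lam 0).parts = lam.parts := by
  haveI : NeZero (lam.parts.card + 1) := ⟨Nat.succ_ne_zero _⟩
  refine parts_eq_of_ofPartition_eq (N := lam.parts.card + 1) ?_
    ((card_parts_rowLift_le lam 0).trans (max_le (Nat.le_succ _) (by omega))) (Nat.le_succ _)
  rw [ofPartition_rowLift]
  simp

/-- **One stability step in the `m`-rows orientation** (Manivel 2011 Thm. 1 / IP Thm. 2.1, upper
half): for `|λ̄| ≤ m`, `g(λ♯(m+j+1), (m+j+1) × d, (m+j+1) × d) ≤ g(λ♯(m+j), (m+j) × d, (m+j) × d)` —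
transpose to `d` rows (`kroneckerCoeff_rectangle_transpose`) and apply
`kroneckerCoeff_rectangle_succ_le`; the hypothesis `(m+j+1)(d-1) < λ₁ + (j+1)d` holds since
`λ₁ ≥ m d - m`. [cite: IkenmeyerPanova2017, Thm. 2.1 (held: Thm. 8); Manivel2011, Thm. 1] -/
theorem kroneckerCoeff_rowLift_succ_le (lam : Nat.Partition (m * d)) (hbody : bodySize lam ≤ m) (j : ℕ) :
    kroneckerCoeff ℂ (rowLift lam (j + 1)) (Nat.Partition.rectangle (m + (j + 1)) d)
        (Nat.Partition.rectangle (m + (j + 1)) d) ≤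
      kroneckerCoeff ℂ (rowLift lam j) (Nat.Partition.rectangle (m + j) d)
        (Nat.Partition.rectangle (m + j) d) := by
  -- the transposed partitions (`d` rows)
  let T : Nat.Partition (d * (m + j)) :=
    ⟨(rowLift lam j).parts, fun h => (rowLift lam j).parts_pos h, by rw [Nat.Partition.parts_sum]; ring⟩
  let Tbig : Nat.Partition (d * (m + j) + d) :=
    ⟨(rowLift lam (j + 1)).parts, fun h => (rowLift lam (j + 1)).parts_pos h,
      by rw [Nat.Partition.parts_sum]; ring⟩
  have hT : kroneckerCoeff ℂ (rowLift lam j) (Nat.Partition.rectangle (m + j) d)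
      (Nat.Partition.rectangle (m + j) d) =
      kroneckerCoeff ℂ T (Nat.Partition.rectangle d (m + j)) (Nat.Partition.rectangle d (m + j)) :=
    kroneckerCoeff_rectangle_transpose (rowLift lam j) T rfl
  have hTbig : kroneckerCoeff ℂ (rowLift lam (j + 1)) (Nat.Partition.rectangle (m + (j + 1)) d)
      (Nat.Partition.rectangle (m + (j + 1)) d) =
      kroneckerCoeff ℂ Tbig (Nat.Partition.rectangle d (m + j + 1)) (Nat.Partition.rectangle d (m + j + 1)) :=
    kroneckerCoeff_rectangle_transpose (rowLift lam (j + 1)) Tbig rfl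
  rw [hT, hTbig]
  -- alphabet size
  set K := d + lam.parts.card + 1 with hK
  haveI : NeZero K := ⟨by omega⟩
  have hcard : ∀ j', (rowLift lam j').parts.card ≤ K := fun j' =>
    (card_parts_rowLift_le lam j').trans (max_le (by omega) (by omega))
  have hwt : ∀ j', Weight.ofPartition K (rowLift lam j') =
      Weight.ofPartition K lam + Pi.single 0 ((j' * d : ℕ) : ℤ) := fun j' => ofPartition_rowLift K lam j'
  have hwT : Weight.ofPartition K T = Weight.ofPartition K (rowLift lam j) := by
    funext i; rfl
  have hwTbig : Weight.ofPartition K Tbig = Weight.ofPartition K (rowLift lam (j + 1)) := by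
    funext i; rfl
  refine kroneckerCoeff_rectangle_succ_le ℂ (N := K) (by omega) T Tbig (hcard j) (hcard (j + 1)) ?_ ?_
  · rw [hwT, hwTbig, hwt, hwt, add_assoc, ← Pi.single_add]
    congr 2
    push_cast
    ring
  · rw [hwTbig, ofPartition_rowLift_zero]
    have h1 : ((m * d : ℕ) : ℤ) ≤ (lam.parts.sup : ℤ) + m := by
      have := sup_parts_le lam
      unfold bodySize at hbody
      exact_mod_cast (show m * d ≤ lam.parts.sup + m by omega)
    push_cast at h1 ⊢
    linarith

/-- **Iterated stability (IP's use of Thm. 2.1: "`(n, d) ∈ St¹(ρ)` … for all `n ≥ m`")**: for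
`|λ̄| ≤ m` and every `j`, `g(λ♯(m+j), (m+j) × d, (m+j) × d) ≤ g(λ, m × d, m × d)`.
[cite: IkenmeyerPanova2017, Thm. 2.1 (held: Thm. 8) and proof of Prop. 2.8 (held: Prop. 15)] -/
theorem kroneckerCoeff_rowLift_le (lam : Nat.Partition (m * d)) (hbody : bodySize lam ≤ m) :
    ∀ j : ℕ, kroneckerCoeff ℂ (rowLift lam j) (Nat.Partition.rectangle (m + j) d)
        (Nat.Partition.rectangle (m + j) d) ≤
      kroneckerCoeff ℂ lam (Nat.Partition.rectangle m d) (Nat.Partition.rectangle m d)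
  | 0 => (kroneckerCoeff_congr_parts (by ring) (lam' := lam) (mu' := Nat.Partition.rectangle m d)
      (nu' := Nat.Partition.rectangle m d) (parts_rowLift_zero lam) rfl rfl).le
  | j + 1 => (kroneckerCoeff_rowLift_succ_le lam hbody j).trans (kroneckerCoeff_rowLift_le lam hbody j)

end RowLift

/-! ### The final lexicographic segment `MatIdx m ↪ MatIdx N` -/

section Segment

variable {m N : ℕ}

/-- The embedding of the `m²` matrix indices of `MatIdx m` onto the LAST `m²` indices of `MatIdx N`
in the lexicographic enumerations (`matIdxEquiv`), for `m ≤ N`. Its image is an upper set and it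
maps the top index to the top index, which is what the transfer of highest-weight vectors
(`rename_mem_highestWeightSpace_coordRep`) and the inner lifting at `topMatIdx N` require.
[cite: IkenmeyerPanova2017, §2.2 (proof of Prop. 2.6(b); held: Prop. 13(b))] -/
def segEmb (hmN : m ≤ N) (x : MatIdx m) : MatIdx N :=
  matIdxEquiv N ⟨((matIdxEquiv m).symm x : ℕ) + (N * N - m * m), by
    have h1 := ((matIdxEquiv m).symm x).2
    have h2 : m * m ≤ N * N := Nat.mul_le_mul hmN hmN
    omega⟩

/-- The position of `segEmb x` in the enumeration of `MatIdx N`. [folklore] -/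
theorem matIdxEquiv_symm_segEmb (hmN : m ≤ N) (x : MatIdx m) :
    (((matIdxEquiv N).symm (segEmb hmN x) : Fin (N * N)) : ℕ) =
      ((matIdxEquiv m).symm x : ℕ) + (N * N - m * m) := by
  rw [segEmb, OrderIso.symm_apply_apply]

/-- `segEmb` is strictly monotone. [folklore] -/
theorem segEmb_strictMono (hmN : m ≤ N) : StrictMono (segEmb hmN) := by
  intro x y hxy
  rw [segEmb, segEmb, OrderIso.lt_iff_lt, Fin.lt_def]
  have : (matIdxEquiv m).symm x < (matIdxEquiv m).symm y := (OrderIso.lt_iff_lt _).2 hxy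
  exact Nat.add_lt_add_right (Fin.lt_def.1 this) _

/-- The image of `segEmb` is an upper set. [folklore] -/
theorem segEmb_upper (hmN : m ≤ N) (x : MatIdx m) (y : MatIdx N) (hxy : segEmb hmN x ≤ y) :
    ∃ x', segEmb hmN x' = y := by
  have h2 : m * m ≤ N * N := Nat.mul_le_mul hmN hmN
  have hle : ((matIdxEquiv N).symm (segEmb hmN x) : ℕ) ≤ ((matIdxEquiv N).symm y : ℕ) :=
    Fin.le_def.1 ((OrderIso.le_iff_le _).2 hxy)
  rw [matIdxEquiv_symm_segEmb] at hle
  have hy := ((matIdxEquiv N).symm y).2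
  refine ⟨matIdxEquiv m ⟨((matIdxEquiv N).symm y : ℕ) - (N * N - m * m), by omega⟩, ?_⟩
  apply (matIdxEquiv N).symm.injective
  apply Fin.ext
  rw [matIdxEquiv_symm_segEmb, OrderIso.symm_apply_apply]
  simp only
  omega

/-- The image of `segEmb` is an upper set (Mathlib form). [folklore] -/
theorem isUpperSet_range_segEmb (hmN : m ≤ N) : IsUpperSet (Set.range (segEmb hmN)) := by
  rintro y y' hyy' ⟨x, rfl⟩
  exact segEmb_upper hmN x y' hyy'

/-- `segEmb` maps the top index to the top index (`0 < m`). [folklore] -/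
theorem segEmb_topMatIdx (hmN : m ≤ N) [NeZero m] [NeZero N] :
    segEmb hmN (topMatIdx m) = topMatIdx N := by
  have hm : 1 ≤ m * m := Nat.one_le_iff_ne_zero.2 (mul_ne_zero (NeZero.ne m) (NeZero.ne m))
  have h2 : m * m ≤ N * N := Nat.mul_le_mul hmN hmN
  apply (matIdxEquiv N).symm.injective
  apply Fin.ext
  rw [matIdxEquiv_symm_segEmb, topMatIdx, topMatIdx, OrderIso.symm_apply_apply, OrderIso.symm_apply_apply]
  simp only
  omega

end Segment

/-! ### The weight of the lift: `extend (λ^*) 0 - (j d) ε_top = (λ♯(m+j))^*` -/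

section LiftWeight

variable {m d : ℕ}

/-- The weight `partitionWeightLex M μ` at an index of position `p` (in the enumeration of
`MatIdx M`) is `-μ_{M²-1-p}` (rows counted from `0`). [folklore] -/
theorem partitionWeightLex_apply {M D : ℕ} (mu : Nat.Partition D) (y : MatIdx M) :
    partitionWeightLex M mu y =
      -((mu.sortedParts.getD (M * M - (((matIdxEquiv M).symm y : ℕ) + 1)) 0 : ℕ) : ℤ) := by
  rw [partitionWeightLex, Weight.toMatIdx, Weight.dualOfPartition, Weight.dual, Weight.ofPartition,
    Fin.val_rev]

/-- **The weight of the lifted highest-weight vector is `(λ♯N)^*`.** For `N = m + j` and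
`λ ⊢ m·d` with at most `m²` parts:
`extend segEmb (partitionWeightLex m λ) 0 + (-(j d)) ε_{top} = partitionWeightLex N (λ♯N)`.
(Off the segment both sides vanish because `λ♯N` has at most `m²` parts; on the segment the
reversed positions agree, and the top index carries the first row.)
[cite: IkenmeyerPanova2017, Prop. 2.6(b) (held: Prop. 13(b)): weight λ + (d(n-m))] -/
theorem partitionWeightLex_rowLift [NeZero m] (lam : Nat.Partition (m * d)) (hlam : lam.parts.card ≤ m * m)
    (j : ℕ) [NeZero (m + j)] :
    Function.extend (segEmb (Nat.le_add_right m j)) (partitionWeightLex m lam) 0 +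
        Pi.single (topMatIdx (m + j)) (-((j * d : ℕ) : ℤ)) =
      partitionWeightLex (m + j) (rowLift lam j) := by
  classical
  set N := m + j with hNdef
  have hmN : m ≤ N := Nat.le_add_right m j
  have hm : 1 ≤ m * m := Nat.one_le_iff_ne_zero.2 (mul_ne_zero (NeZero.ne m) (NeZero.ne m))
  have h2 : m * m ≤ N * N := Nat.mul_le_mul hmN hmN
  funext y
  rw [Pi.add_apply, partitionWeightLex_apply, getD_sortedParts_rowLift]
  by_cases hy : ∃ x, segEmb hmN x = y
  · obtain ⟨x, rfl⟩ := hy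
    rw [(segEmb_strictMono hmN).injective.extend_apply, partitionWeightLex_apply,
      matIdxEquiv_symm_segEmb]
    have hx := ((matIdxEquiv m).symm x).2
    have hpos : N * N - (((matIdxEquiv m).symm x : ℕ) + (N * N - m * m) + 1) =
        m * m - (((matIdxEquiv m).symm x : ℕ) + 1) := by omega
    rw [hpos]
    by_cases htop : x = topMatIdx m
    · subst htop
      have hidx : m * m - (((matIdxEquiv m).symm (topMatIdx m) : ℕ) + 1) = 0 := by
        rw [topMatIdx, OrderIso.symm_apply_apply]
        simp only
        omega
      rw [segEmb_topMatIdx hmN, Pi.single_eq_same, hidx, if_pos rfl]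
      push_cast
      ring
    · have hne : segEmb hmN x ≠ topMatIdx N := by
        rw [← segEmb_topMatIdx hmN]
        exact fun h => htop ((segEmb_strictMono hmN).injective h)
      rw [Pi.single_eq_of_ne hne, add_zero]
      have hne' : m * m - (((matIdxEquiv m).symm x : ℕ) + 1) ≠ 0 := by
        intro h0
        apply htop
        apply (matIdxEquiv m).symm.injective
        apply Fin.ext
        rw [topMatIdx, OrderIso.symm_apply_apply]
        simp only
        omega
      rw [if_neg hne', add_zero]
  · push Not at hy
    rw [Function.extend_apply' _ _ _ (fun ⟨x, hx⟩ => hy x hx), Pi.zero_apply, zero_add]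
    have hne : y ≠ topMatIdx N := by
      rw [← segEmb_topMatIdx hmN]; exact fun h => hy _ h.symm
    rw [Pi.single_eq_of_ne hne]
    -- `y` lies below the segment, so its reversed position is `≥ m²`, beyond the parts of `λ♯`
    have hlt : ((matIdxEquiv N).symm y : ℕ) < N * N - m * m := by
      by_contra hge
      push Not at hge
      obtain ⟨x', hx'⟩ := segEmb_upper hmN (matIdxEquiv m ⟨0, hm⟩) y (by
        rw [← (matIdxEquiv N).symm.le_iff_le, Fin.le_def, matIdxEquiv_symm_segEmb,
          OrderIso.symm_apply_apply]
        simpa using hge)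
      exact hy x' hx'
    have hq : m * m ≤ N * N - (((matIdxEquiv N).symm y : ℕ) + 1) := by omega
    have hne' : N * N - (((matIdxEquiv N).symm y : ℕ) + 1) ≠ 0 := by omega
    rw [if_neg hne', add_zero, getD_sortedParts_eq_zero lam (hlam.trans hq)]
    simp

end LiftWeight

/-! ### The lifting of highest-weight vectors and its values on padded forms -/

section Lift

variable {m : ℕ}

/-- **The Kadish–Landsberg lifting of IP Prop. 2.6(b), dual form**: rename the variables along
the final segment (`degIdxMap`, the inheritance device of `NotViaSaturationsChowProofs.lean`) and
lift the inner degree at the top index, `L F = innerLift (topMatIdx N) m N (rename (degIdxMap segEmb) F)`.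
[cite: IkenmeyerPanova2017, Prop. 2.6(b) (held: Prop. 13(b)), proof ("they construct a highest weight vector P^{♯n}")] -/
def liftHWV (m j : ℕ) [NeZero (m + j)] :
    MvPolynomial (DegIdx (MatIdx m) m) ℂ →ₐ[ℂ] MvPolynomial (DegIdx (MatIdx (m + j)) (m + j)) ℂ :=
  (innerLift (topMatIdx (m + j)) m (m + j)).comp
    (rename (degIdxMap (m := m) (segEmb_strictMono (Nat.le_add_right m j)).injective))

/-- **Evaluation of a renamed polynomial function** (`F ↦ F ∘ res`, the outer half of the
Kadish–Landsberg lifting): `(rename (degIdxMap hι) F)(q) = F(killCompl hι q)` on coefficient vectors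
of forms. [cite: IkenmeyerPanova2017, §2.2 (proof of Prop. 2.6(b); held: Prop. 13(b))] -/
theorem aeval_formCoeff_rename_degIdxMap {σ τ : Type*} [Fintype σ] [LinearOrder σ] [Fintype τ]
    [LinearOrder τ] {ι : σ → τ} (hι : Function.Injective ι) {n : ℕ} (q : MvPolynomial τ ℂ)
    (F : MvPolynomial (DegIdx σ n) ℂ) :
    aeval (formCoeff n q) (rename (degIdxMap hι) F) = aeval (formCoeff n (killCompl hι q)) F := by
  rw [aeval_rename]
  refine congrArg (fun p : DegIdx σ n → ℂ => aeval p F) (funext fun d => ?_)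
  rw [Function.comp_apply, formCoeff_apply, formCoeff_apply, degIdxMap_val, coeff_killCompl]

/-- The size of `partitionWeightLex m λ`, `λ ⊢ m·d` with at most `m²` parts, is `-(m d)` (a weight
pins the degree: highest-weight vectors of this weight are forms of degree `d`). [folklore] -/
theorem size_partitionWeightLex' {d : ℕ} (lam : Nat.Partition (m * d)) (hlam : lam.parts.card ≤ m * m) :
    Weight.size (partitionWeightLex m lam) = -((m * d : ℕ) : ℤ) := by
  rw [partitionWeightLex, Weight.size_toMatIdx, Weight.dualOfPartition, Weight.size_dual,
    Weight.size_ofPartition_holds hlam]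

/-- **The lift of a highest-weight vector of weight `λ^*` is a highest-weight vector of weight
`(λ♯N)^*`** (`rename_mem_highestWeightSpace_coordRep` + BIP Lemma 5.3
`innerLift_mem_highestWeightSpace` + `partitionWeightLex_rowLift`).
[cite: IkenmeyerPanova2017, Prop. 2.6(b) (held: Prop. 13(b)), proof] -/
theorem liftHWV_mem_highestWeightSpace [NeZero m] {d : ℕ} (lam : Nat.Partition (m * d))
    (hlam : lam.parts.card ≤ m * m) (j : ℕ) [NeZero (m + j)] {F : MvPolynomial (DegIdx (MatIdx m) m) ℂ}
    (hF : F ∈ highestWeightSpace (coordRep (MatIdx m) ℂ m) (partitionWeightLex m lam)) :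
    liftHWV m j F ∈ highestWeightSpace (coordRep (MatIdx (m + j)) ℂ (m + j))
      (partitionWeightLex (m + j) (rowLift lam j)) := by
  have hmN : m ≤ m + j := Nat.le_add_right m j
  have hhom : F.IsHomogeneous d :=
    isHomogeneous_of_mem_highestWeightSpace (NeZero.ne m) hF (size_partitionWeightLex' lam hlam)
  have h1 := rename_mem_highestWeightSpace_coordRep (k := ℂ) (m := m) (segEmb_strictMono hmN)
    (isUpperSet_range_segEmb hmN) hF
  have h2 := innerLift_mem_highestWeightSpace (k := ℂ) (topMatIdx (m + j)) (le_topMatIdx (m + j)) hmN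
    (hhom.rename_isHomogeneous (f := degIdxMap (segEmb_strictMono hmN).injective)) h1
  rw [Nat.add_sub_cancel_left, partitionWeightLex_rowLift lam hlam j] at h2
  exact h2

/-- The padded form `X_top^{j} · f(x_segment)` of a form `f` in the `m²` variables, placed on the
final segment of the `N²` variables, `N = m + j` (IP's `f^{♯n} = X_{1,1}^{n-m} f` up to the choice
of the block and of the padding variable, which is immaterial inside `GL_{N²}`-orbit closures).
[cite: IkenmeyerPanova2017, §2.2 (f^{♯n})] -/
def paddedForm (m j : ℕ) [NeZero (m + j)] (f : MvPolynomial (MatIdx m) ℂ) : MvPolynomial (MatIdx (m + j)) ℂ :=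
  X (topMatIdx (m + j)) ^ j * rename (segEmb (Nat.le_add_right m j)) f

/-- The padded form of a form of degree `m` is a form of degree `m + j`. [folklore] -/
theorem isHomogeneous_paddedForm (j : ℕ) [NeZero (m + j)] {f : MvPolynomial (MatIdx m) ℂ}
    (hf : f.IsHomogeneous m) : (paddedForm m j f).IsHomogeneous (m + j) := by
  have h := ((isHomogeneous_X ℂ (topMatIdx (m + j))).pow j).mul
    (hf.rename_isHomogeneous (f := segEmb (Nat.le_add_right m j)))
  have he : 1 * j + m = m + j := by ring
  rw [he] at h
  exact h

/-- **Values of the lift on padded forms (BIP Thm. 5.4 + Lemma 5.2, and the restriction to the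
segment)**: `(L F)(X_top^j · f) = F(Δ f)` where `Δ` rescales the coefficient of `x^e` by the
positive integer `(e_top + j)!/e_top!`. In print (IP, after Kadish–Landsberg):
"`P(f) = P^{♯n}(f^{♯n})`" — here up to the harmless diagonal automorphism `Δ` of `V_m` coming from
dropping BIP's normalisation of the lifting.
[cite: IkenmeyerPanova2017, Prop. 2.6(b) (held: Prop. 13(b)), proof; BurgisserIkenmeyerPanovaJAMS2019, Thm. 5.4 and Lemma 5.2] -/
theorem aeval_formCoeff_paddedForm_liftHWV [NeZero m] (j : ℕ) [NeZero (m + j)] {f : MvPolynomial (MatIdx m) ℂ}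
    (hf : f.IsHomogeneous m) (F : MvPolynomial (DegIdx (MatIdx m) m) ℂ) :
    aeval (formCoeff (m + j) (paddedForm m j f)) (liftHWV m j F) =
      aeval (fun e : DegIdx (MatIdx m) m =>
        (((e.1 (topMatIdx m) + j).descFactorial j : ℕ) : ℂ) * coeff e.1 f) F := by
  have hmN : m ≤ m + j := Nat.le_add_right m j
  have hι := (segEmb_strictMono hmN).injective
  rw [liftHWV, AlgHom.comp_apply, aeval_formCoeff_innerLift _ (isHomogeneous_paddedForm j hf),
    Nat.add_sub_cancel_left, aeval_formCoeff_rename_degIdxMap hι]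
  refine congrArg (fun p : DegIdx (MatIdx m) m → ℂ => aeval p F) (funext fun e => ?_)
  rw [formCoeff_apply, coeff_killCompl, ← degIdxMap_val hι, ← formCoeff_apply, paddedForm,
    formCoeff_iterPderiv_X_pow_mul _ _ hf.rename_isHomogeneous, formCoeff_apply, degIdxMap_val,
    coeff_rename_mapDomain _ hι, ← segEmb_topMatIdx hmN, Finsupp.mapDomain_apply hι]

/-- **Every padded form lies in `Ω_N = \overline{GL_{N²} det_N}`** as soon as `f` has an affine
determinantal representation of size `N = m + j` (Mulmuley–Sohoni's homogenisation
`X_pow_mul_rename_mem_endOrbit_detPoly`, `End · det ⊆ Ω`, transported to the lexicographic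
variables). IP: "dc(f) ≤ n for all f ∈ V_m … implies Γ^n_m ⊆ \overline{GL_{n²} det_n}".
[cite: IkenmeyerPanova2017, Prop. 2.5 (held: Prop. 12), proof; MulmuleySohoni2001, Prop. 4.4] -/
theorem paddedForm_mem_orbitClosure_detFormLex (j : ℕ) [NeZero (m + j)] {f : MvPolynomial (MatIdx m) ℂ}
    (hf : f.IsHomogeneous m) (hA : HasDetRepr f (m + j)) :
    paddedForm m j f ∈ orbitClosure (detFormLex ℂ (m + j)) := by
  classical
  set N := m + j with hN
  have hmem := X_pow_mul_rename_mem_endOrbit_detPoly (k := ℂ) hf (Nat.le_add_right m j) hA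
    (fun x => ofLex (segEmb (Nat.le_add_right m j) x)) (ofLex (topMatIdx N))
  have hcl := endOrbit_subset_orbitClosure_holds _ hmem
  have hren : rename (toLex : Fin N × Fin N → MatIdx N)
      (X (ofLex (topMatIdx N)) ^ (m + j - m) *
        rename (fun x => ofLex (segEmb (Nat.le_add_right m j) x)) f) = paddedForm m j f := by
    rw [map_mul, map_pow, rename_X, toLex_ofLex, rename_rename, Nat.add_sub_cancel_left, paddedForm]
    rfl
  rw [← hren, detFormLex]
  exact (rename_mem_orbitClosure_rename_iff_holds toLex (detPoly (Fin N) ℂ) _).2 hcl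

end Lift

/-! ### The inequality of multiplicities -/

section Inequality

/-- **`a_λ(d[m]) ≤ mult_{λ♯N} ℂ[Ω_N]` for `N = m + j` whenever every `f ∈ V_m` has an affine
determinantal representation of size `N`** (IP Prop. 2.6(b) combined with the first half of
Prop. 2.5): the lifts `L F` of the highest-weight vectors of weight `λ^*`, reduced modulo
`I(Ω_N)`, are highest-weight vectors of weight `(λ♯N)^*` in `ℂ[Ω_N]`, and `F ↦ L F mod I(Ω_N)` is
injective — if `L F` vanishes on `Ω_N` it vanishes at every padded form, i.e. `F(Δ f) = 0` for all
`f ∈ V_m`, and `Δ` is onto (IP: "the evaluation matrix … has full rank").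
[cite: IkenmeyerPanova2017, Prop. 2.6(b) (held: Prop. 13(b)) and Prop. 2.5 (held: Prop. 12)] -/
theorem plethysmCoeff_le_orbitMultiplicity_rowLift {m d : ℕ} [NeZero m] (lam : Nat.Partition (m * d))
    (hlam : lam.parts.card ≤ m * m) (j : ℕ) [NeZero (m + j)]
    (hdc : ∀ f : MvPolynomial (MatIdx m) ℂ, f.IsHomogeneous m → HasDetRepr f (m + j)) :
    plethysmCoeff ℂ (MatIdx m) m (partitionWeightLex m lam) ≤
      orbitMultiplicity ℂ (detFormLex ℂ (m + j)) (m + j) (partitionWeightLex (m + j) (rowLift lam j)) := by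
  classical
  set N := m + j with hN
  set χ := partitionWeightLex m lam with hχ
  set χN := partitionWeightLex N (rowLift lam j) with hχN
  set HW := highestWeightSpace (coordRep (MatIdx m) ℂ m) χ with hHW
  set I := orbitVanishingIdeal (detFormLex ℂ N) N with hI
  set HW' := highestWeightSpace (orbitCoordRep (detFormLex ℂ N) N) χN with hHW'
  haveI : FiniteDimensional ℂ HW' :=
    finiteDimensional_highestWeightSpace_orbitCoordRep_holds (k := ℂ) (detFormLex ℂ N) (NeZero.ne N) χN
  -- the reduction map is equivariant, hence maps highest-weight vectors to highest-weight vectors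
  let mk : (coordRep (MatIdx N) ℂ N).IntertwiningMap (orbitCoordRep (detFormLex ℂ N) N) :=
    ⟨(Ideal.Quotient.mkₐ ℂ I).toLinearMap, fun _ => LinearMap.ext fun _ => rfl⟩
  have hmem : ∀ F : HW, Ideal.Quotient.mkₐ ℂ I (liftHWV m j (F : MvPolynomial _ ℂ)) ∈ HW' := fun F =>
    highestWeightSpace_le_comap_intertwiningMap mk χN (liftHWV_mem_highestWeightSpace lam hlam j F.2)
  -- the linear map `F ↦ L F mod I(Ω_N)`
  let Φ : HW →ₗ[ℂ] HW' :=
    LinearMap.codRestrict HW' ((Ideal.Quotient.mkₐ ℂ I).toLinearMap.comp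
      ((liftHWV m j).toLinearMap.comp HW.subtype)) hmem
  have hΦ : Function.Injective Φ := by
    rw [← LinearMap.ker_eq_bot, LinearMap.ker_eq_bot']
    intro F hF0
    have h0 : Ideal.Quotient.mkₐ ℂ I (liftHWV m j (F : MvPolynomial _ ℂ)) = 0 := congrArg Subtype.val hF0
    have hI' : liftHWV m j (F : MvPolynomial _ ℂ) ∈ I := by
      rwa [Ideal.Quotient.mkₐ_eq_mk, Ideal.Quotient.eq_zero_iff_mem] at h0
    -- `F(Δ f) = 0` for every `f ∈ V_m`
    have hvan : ∀ f : MvPolynomial (MatIdx m) ℂ, f.IsHomogeneous m →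
        aeval (fun e : DegIdx (MatIdx m) m =>
          (((e.1 (topMatIdx m) + j).descFactorial j : ℕ) : ℂ) * coeff e.1 f) (F : MvPolynomial _ ℂ) = 0 := by
      intro f hf
      rw [← aeval_formCoeff_paddedForm_liftHWV j hf]
      exact aeval_formCoeff_eq_zero_of_mem_orbitClosure_detFormLex
        (paddedForm_mem_orbitClosure_detFormLex j hf (hdc f hf)) hI'
    -- `Δ` is onto, so `F` vanishes everywhere
    apply Subtype.ext
    refine MvPolynomial.funext fun x => ?_
    rw [ZeroMemClass.coe_zero, map_zero]
    obtain ⟨f, hf, hcoeff⟩ := exists_formCoeff_eq (k := ℂ)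
      (fun e : DegIdx (MatIdx m) m => x e / (((e.1 (topMatIdx m) + j).descFactorial j : ℕ) : ℂ))
    have hx : (fun e : DegIdx (MatIdx m) m =>
        (((e.1 (topMatIdx m) + j).descFactorial j : ℕ) : ℂ) * coeff e.1 f) = x := by
      funext e
      have hc : ((((e.1 (topMatIdx m) + j).descFactorial j : ℕ) : ℂ)) ≠ 0 :=
        Nat.cast_ne_zero.2 (descFactorial_add_pos _ _).ne'
      have := congrFun hcoeff e
      rw [formCoeff_apply] at this
      rw [this, mul_div_cancel₀ _ hc]
    have h := hvan f hf
    rw [hx] at h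
    exact h
  -- dimensions
  haveI : FiniteDimensional ℂ HW :=
    finiteDimensional_highestWeightSpace_coordRep_holds (k := ℂ) (σ := MatIdx m) (NeZero.ne m) χ
  exact LinearMap.finrank_le_finrank_of_injective hΦ

/-- **Discharge of `ikenmeyerPanova2017_prop_2_8` (IP Prop. 2.8 = held Prop. 15, inequality of
multiplicities).** For `λ ⊢ m·d` with at most `m²` parts and `|λ̄| ≤ m`:
`a_λ(d[m]) ≤ g(λ, m × d, m × d)`. Chain (module docstring of this appendix): uniform Valiant size
`C` (Lemma 2.7), `N = m + C`; lifting + padding give `a_λ(d[m]) ≤ mult_{λ♯N} ℂ[Ω_N]`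
(`plethysmCoeff_le_orbitMultiplicity_rowLift`, Prop. 2.6(b) with Prop. 2.5); the algebraic
Peter–Weyl theorem gives `mult_{λ♯N} ℂ[Ω_N] ≤ g(λ♯N, N × d, N × d)`
(`orbitMultiplicity_det_le_kroneckerCoeff_holds`, Prop. 2.5); Manivel's stability gives
`g(λ♯N, N × d, N × d) ≤ g(λ, m × d, m × d)` (`kroneckerCoeff_rowLift_le`, Thm. 2.1, using
`|λ̄| ≤ m`). [cite: IkenmeyerPanova2017, Prop. 2.8 (held: Prop. 15)] -/
theorem ikenmeyerPanova2017_prop_2_8_holds : ikenmeyerPanova2017_prop_2_8 := by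
  intro m d _ lam hlam hbody
  -- Lemma 2.7: one size of determinantal representation for all of `V_m`
  obtain ⟨C, hC⟩ := exists_forall_hasDetRepr_of_isHomogeneous (k := ℂ) (σ := MatIdx m) m
  haveI : NeZero (m + C) := ⟨by have := NeZero.ne m; omega⟩
  have hdc : ∀ f : MvPolynomial (MatIdx m) ℂ, f.IsHomogeneous m → HasDetRepr f (m + C) :=
    fun f hf => HasDetRepr.mono_holds (hC f hf) (Nat.le_add_left C m)
  calc plethysmCoeff ℂ (MatIdx m) m (partitionWeightLex m lam)
      ≤ orbitMultiplicity ℂ (detFormLex ℂ (m + C)) (m + C) (partitionWeightLex (m + C) (rowLift lam C)) :=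
        plethysmCoeff_le_orbitMultiplicity_rowLift lam hlam C hdc
    _ ≤ kroneckerCoeff ℂ (rowLift lam C) (Nat.Partition.rectangle (m + C) d)
          (Nat.Partition.rectangle (m + C) d) :=
        orbitMultiplicity_det_le_kroneckerCoeff_holds (k := ℂ) (rowLift lam C)
          ((card_parts_rowLift_le lam C).trans (max_le (hlam.trans (Nat.mul_le_mul
            (Nat.le_add_right m C) (Nat.le_add_right m C))) (Nat.one_le_iff_ne_zero.2
            (mul_ne_zero (NeZero.ne (m + C)) (NeZero.ne (m + C))))))
    _ ≤ kroneckerCoeff ℂ lam (Nat.Partition.rectangle m d) (Nat.Partition.rectangle m d) :=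
        kroneckerCoeff_rowLift_le lam hbody C

end Inequality

end Literature.Computability.Complexity
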